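import Literature.NumberTheory.Automorphic.HeckeFamilyTraceMultiplicity
import Literature.NumberTheory.Transcendental.RoySmallValueEstimatesRecurrenceProofs
import Literature.NumberTheory.LFunctions.RankinEisensteinFactorisation
import Mathlib.LinearAlgebra.Eigenspace.Minpoly
import HarnessLib

/-!
# A square-indicator defect between the traces of two Hecke families vanishes

Topic `NumberTheory/Automorphic`; pure linear algebra, theorems and definitions with bodies only
(no named fact).  Complement to `HeckeFamilyTraceMultiplicity.lean` (the engine of Pizer's proof
of Eichler's basis theorem, J. Algebra 64 (1980), Thm. 2.28): when the traces of two semisimple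
Hecke families `T_A`, `T_B` away from `N` (prime-power constants `c`) are compared through the two
classical trace formulas, the only term that is not known termwise is the MASS term, which
contributes `δ(n = □) · c₀` for an unknown constant `c₀` (the difference between the mass
`Σ 1/wᵢ` of the quaternion order and its expected value).  We prove that such a defect is
automatically zero:

* `eq_zero_of_trace_eq_trace_add_indicator_isSquare` /
  `trace_eq_of_trace_eq_trace_add_indicator_isSquare` — if `tr T_A(n) = tr T_B(n) + δ(n = □) c₀`
  for all `n ≥ 1` prime to `N`, and at one prime `q ∤ N` the constant `κ = c(q)` is not `0`, `1`
  or `-1` (e.g. `c(q) = q^{k-1}`, `k ≥ 2`), then `c₀ = 0` (hence the traces agree and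
  `finrank_eigenChar_eq_of_trace_eq` applies).
* `eq_zero_of_heckeU_sum_eq_indicator_even'` — the underlying statement about the sequences
  `U_a(x)`: `Σ_x D(x) U_a(x) = c₀ δ(a even)` for all `a` forces `c₀ = 0`.

Proof.  On a simultaneous eigenvector with `T(q) v = x v` one has `T(q^a) v = U_a(x) v` with the
Hecke polynomials `U_0 = 1`, `U_1 = x`, `U_{a+2} = x U_{a+1} - κ U_a` (`heckeU`,
`IsHeckeFamily.apply_prime_pow_of_mem_eigenChar`), so `tr T(q^a) = Σ_χ dim V_χ · U_a(χ(q))` and the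
hypothesis at `n = q^a` reads `Σ_x D(x) U_a(x) = c₀ δ(a even)` for a finitely supported `D`.  The
sequence `a ↦ U_a(x)` is killed by `S² - x S + κ` (`S` the shift on `ℕ → ℂ`); applying
`P(S) = ∏_{x ≠ κ+1} (S² - x S + κ)` kills all terms except those along `U(κ + 1) =
(κ g_κ - g_1)/(κ - 1)` and `δ(a even) = (g_1 + g_{-1})/2`, where the geometric sequences `g_r` are
eigenvectors of `S` with the distinct eigenvalues `κ, 1, -1`, hence linearly independent; reading
off the `g_κ`- and `g_1`-coordinates gives `D(κ+1) = 0` and then `c₀ P(1) = 0` with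
`P(1) = ∏ (1 - x + κ) ≠ 0`.  (Equivalently: `Σ_x D(x)/(1 - x t + κ t²) = c₀/(1 - t²)` is impossible
for `c₀ ≠ 0` by comparing poles.)

## References

* [Pizer1980] A. Pizer, J. Algebra 64 (1980) 340–390, Prop. 2.22, Thm. 2.25 (2.8), Thm. 2.28.
* [Eichler1973] M. Eichler, LNM 320 (1973), Ch. II §6 Thm. 2 (the recursion for `T(p^a)`).
-/

noncomputable section

open Module Module.End Polynomial
open Literature.NumberTheory.Transcendental.NguyenRoy (shiftOp shiftOp_apply)
open Literature.NumberTheory.LFunctions.RankinEisenstein (isSquare_prime_pow_iff)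

namespace Literature.NumberTheory.Automorphic

/-! ### The prime-power Hecke polynomials `U_a` -/

/-- The **prime-power Hecke polynomials** `U_a(x)` with constant `κ`, as a sequence in `a`:
`U_0 = 1`, `U_1 = x`, `U_{a+2} = x U_{a+1} - κ U_a` (so that `T(q^a) = U_a(T(q))` for a Hecke
family with `c(q) = κ`; scaled Chebyshev polynomials of the second kind). [cite: Eichler1973, Ch. II §6 Thm. 2] -/
def heckeU (κ x : ℂ) : ℕ → ℂ
  | 0 => 1
  | 1 => x
  | a + 2 => x * heckeU κ x (a + 1) - κ * heckeU κ x a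

/-- `U_0 = 1`. [folklore] -/
@[simp] theorem heckeU_zero (κ x : ℂ) : heckeU κ x 0 = 1 := rfl

/-- `U_1 = x`. [folklore] -/
@[simp] theorem heckeU_one (κ x : ℂ) : heckeU κ x 1 = x := rfl

/-- The recursion `U_{a+2} = x U_{a+1} - κ U_a`. [folklore] -/
theorem heckeU_add_two (κ x : ℂ) (a : ℕ) :
    heckeU κ x (a + 2) = x * heckeU κ x (a + 1) - κ * heckeU κ x a := rfl

/-- **The Eisenstein value**: `U_a(κ + 1) (κ - 1) = κ^{a+1} - 1`, i.e. `U_a(κ + 1) = 1 + κ + ⋯ + κ^a`. [folklore] -/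
theorem heckeU_eis_mul (κ : ℂ) : ∀ a : ℕ, heckeU κ (κ + 1) a * (κ - 1) = κ ^ (a + 1) - 1
  | 0 => by simp
  | 1 => by rw [heckeU_one]; ring
  | a + 2 => by
    have h₁ := heckeU_eis_mul κ (a + 1)
    have h₀ := heckeU_eis_mul κ a
    rw [heckeU_add_two]
    linear_combination (κ + 1) * h₁ - κ * h₀

/-- `U_a(-x) = (-1)^a U_a(x)`. [folklore] -/
theorem heckeU_neg (κ x : ℂ) : ∀ a : ℕ, heckeU κ (-x) a = (-1) ^ a * heckeU κ x a
  | 0 => by simp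
  | 1 => by simp
  | a + 2 => by
    rw [heckeU_add_two, heckeU_add_two, heckeU_neg κ x (a + 1), heckeU_neg κ x a]
    ring

/-! ### Sequences: geometric sequences and the recursion operator in the shift
(the shift `S` on `ℕ → ℂ` is the tree's `NguyenRoy.shiftOp`) -/

/-- The **geometric sequence** `g_r(n) = r^n`. [folklore] -/
def geomSeq (r : ℂ) : ℕ → ℂ := fun n => r ^ n

/-- `g_r(n) = r^n`. [folklore] -/
@[simp] theorem geomSeq_apply (r : ℂ) (n : ℕ) : geomSeq r n = r ^ n := rfl

/-- A geometric sequence is an eigenvector of the shift: `S g_r = r g_r`. [folklore] -/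
theorem shiftOp_geomSeq (r : ℂ) : shiftOp (geomSeq r) = r • geomSeq r := by
  funext n
  simp [pow_succ, mul_comm]

/-- `g_r ≠ 0` (`g_r(0) = 1`). [folklore] -/
theorem geomSeq_ne_zero (r : ℂ) : geomSeq r ≠ 0 := fun h => by
  have := congrFun h 0
  simp at this

/-- The **recursion polynomial** `X² - x X + κ` of the Hecke recursion. [folklore] -/
def heckePoly (κ x : ℂ) : ℂ[X] := X ^ 2 - C x * X + C κ

/-- `(P(S) s)(n) = s(n+2) - x s(n+1) + κ s(n)` for `P = X² - x X + κ`. [folklore] -/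
theorem aeval_shiftOp_heckePoly_apply (κ x : ℂ) (s : ℕ → ℂ) (n : ℕ) :
    aeval shiftOp (heckePoly κ x) s n = s (n + 2) - x * s (n + 1) + κ * s n := by
  simp only [heckePoly, map_add, map_sub, map_mul, aeval_C, aeval_X, pow_two, LinearMap.add_apply,
    LinearMap.sub_apply, Module.End.mul_apply, Module.algebraMap_end_apply, Pi.add_apply, Pi.sub_apply,
    shiftOp_apply, Pi.smul_apply, smul_eq_mul]

/-- `P(r) = r² - x r + κ`. [folklore] -/
theorem eval_heckePoly (κ x r : ℂ) : (heckePoly κ x).eval r = r ^ 2 - x * r + κ := by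
  simp [heckePoly]

/-- **The recursion operator kills `U(x)`**: `(S² - x S + κ) U(x) = 0`. [folklore] -/
theorem aeval_shiftOp_heckePoly_heckeU (κ x : ℂ) : aeval shiftOp (heckePoly κ x) (heckeU κ x) = 0 := by
  funext n
  rw [aeval_shiftOp_heckePoly_apply, heckeU_add_two, Pi.zero_apply]
  ring

/-- A product of recursion operators containing the factor for `x` kills `U(x)`. [folklore] -/
theorem aeval_shiftOp_prod_heckePoly_heckeU (κ : ℂ) {Λ : Finset ℂ} {x : ℂ} (hx : x ∈ Λ) :
    aeval shiftOp (∏ y ∈ Λ, heckePoly κ y) (heckeU κ x) = 0 := by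
  classical
  rw [← Finset.prod_erase_mul Λ _ hx, map_mul, Module.End.mul_apply, aeval_shiftOp_heckePoly_heckeU,
    map_zero]

/-- `P(S) g_r = P(r) g_r`. [folklore] -/
theorem aeval_shiftOp_geomSeq (P : ℂ[X]) (r : ℂ) : aeval shiftOp P (geomSeq r) = P.eval r • geomSeq r :=
  aeval_apply_of_mem_apply_eq_smul (shiftOp_geomSeq r)

/-- **The Eisenstein sequence in the eigenbasis of the shift**:
`U(κ + 1) = κ/(κ - 1) · g_κ - 1/(κ - 1) · g_1` (`κ ≠ 1`). [folklore] -/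
theorem heckeU_eis_eq (κ : ℂ) (hκ1 : κ ≠ 1) :
    heckeU κ (κ + 1) = (κ / (κ - 1)) • geomSeq κ - (1 / (κ - 1)) • geomSeq 1 := by
  have hα : κ - 1 ≠ 0 := sub_ne_zero.mpr hκ1
  funext a
  have h := heckeU_eis_mul κ a
  simp only [Pi.sub_apply, Pi.smul_apply, smul_eq_mul, geomSeq_apply, one_pow, mul_one]
  field_simp
  linear_combination h

/-- **The square indicator in the eigenbasis of the shift**: `δ(a even) = (g_1 + g_{-1})/2`. [folklore] -/
theorem indicator_even_eq :
    (fun a : ℕ => if Even a then (1 : ℂ) else 0) = (1 / 2 : ℂ) • geomSeq 1 + (1 / 2 : ℂ) • geomSeq (-1) := by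
  funext a
  simp only [Pi.add_apply, Pi.smul_apply, smul_eq_mul, geomSeq_apply, one_pow]
  rcases Nat.even_or_odd a with ha | ha
  · rw [if_pos ha, ha.neg_one_pow]; ring
  · rw [if_neg (Nat.not_even_iff_odd.mpr ha), ha.neg_one_pow]; ring

/-- The three geometric sequences `g_κ, g_1, g_{-1}` are linearly independent for `κ ≠ ±1`
(eigenvectors of the shift for distinct eigenvalues). [folklore] -/
theorem linearIndependent_geomSeq_three (κ : ℂ) (hκ1 : κ ≠ 1) (hκ2 : κ ≠ -1) :
    LinearIndependent ℂ ![geomSeq κ, geomSeq 1, geomSeq (-1)] := by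
  refine eigenvectors_linearIndependent' shiftOp ![κ, 1, -1] ?_ _ ?_
  · intro i j hij
    fin_cases i <;> fin_cases j <;> first | rfl | (exfalso; revert hij; simp [hκ1, hκ2, Ne.symm hκ1, Ne.symm hκ2]; try norm_num)
  · intro i
    fin_cases i <;>
      exact hasEigenvector_iff.mpr ⟨mem_eigenspace_iff.mpr (shiftOp_geomSeq _), geomSeq_ne_zero _⟩

/-! ### The core lemma on the sequences `U(x)` -/

/-- **Core lemma.**  If a finite combination of the sequences `U(x)` (`x ≠ κ + 1`) and of
`U(κ + 1)` equals `c₀ · δ(a even)` for all `a`, and `κ ∉ {0, 1, -1}`, then `c₀ = 0`. [folklore] -/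
theorem eq_zero_of_heckeU_sum_eq_indicator_even {κ : ℂ} (hκ0 : κ ≠ 0) (hκ1 : κ ≠ 1) (hκ2 : κ ≠ -1)
    {Λ : Finset ℂ} (hΛ : κ + 1 ∉ Λ) (D : ℂ → ℂ) (Dp c₀ : ℂ)
    (h : ∀ a : ℕ, Dp * heckeU κ (κ + 1) a + ∑ x ∈ Λ, D x * heckeU κ x a = if Even a then c₀ else 0) :
    c₀ = 0 := by
  classical
  set P : ℂ[X] := ∏ y ∈ Λ, heckePoly κ y with hP
  have hα : κ - 1 ≠ 0 := sub_ne_zero.mpr hκ1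
  -- the hypothesis as an identity of sequences
  have hseq : Dp • heckeU κ (κ + 1) + ∑ x ∈ Λ, D x • heckeU κ x =
      c₀ • fun a : ℕ => if Even a then (1 : ℂ) else 0 := by
    funext a
    simp only [Pi.add_apply, Finset.sum_apply, Pi.smul_apply, smul_eq_mul]
    rw [h a]
    split_ifs <;> simp
  -- apply `P(S)`
  have key := congrArg (aeval shiftOp P) hseq
  rw [map_add, map_sum, map_smul, map_smul, heckeU_eis_eq κ hκ1, indicator_even_eq,
    Finset.sum_eq_zero (fun x hx => by rw [map_smul, hP, aeval_shiftOp_prod_heckePoly_heckeU κ hx, smul_zero]),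
    add_zero, map_sub, map_add, map_smul, map_smul, map_smul, map_smul, aeval_shiftOp_geomSeq,
    aeval_shiftOp_geomSeq, aeval_shiftOp_geomSeq] at key
  -- read off coordinates in the independent family `g_κ, g_1, g_{-1}`
  have hli := linearIndependent_geomSeq_three κ hκ1 hκ2
  set g : Fin 3 → ℂ := ![Dp * (κ / (κ - 1)) * P.eval κ,
    -(Dp * (1 / (κ - 1)) * P.eval 1) - c₀ * (1 / 2) * P.eval 1, -(c₀ * (1 / 2) * P.eval (-1))] with hg
  have hsum : ∑ i, g i • ![geomSeq κ, geomSeq 1, geomSeq (-1)] i = 0 := by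
    rw [Fin.sum_univ_three]
    have key' := sub_eq_zero.mpr key
    rw [← key']
    simp only [hg, Matrix.cons_val_zero, Matrix.cons_val_one, Matrix.cons_val]
    funext n
    simp only [Pi.add_apply, Pi.sub_apply, Pi.smul_apply, smul_eq_mul]
    ring
  have hcoef := Fintype.linearIndependent_iff.mp hli g hsum
  have h0 : Dp * (κ / (κ - 1)) * P.eval κ = 0 := by simpa [hg] using hcoef 0
  have h1 : -(Dp * (1 / (κ - 1)) * P.eval 1) - c₀ * (1 / 2) * P.eval 1 = 0 := by simpa [hg] using hcoef 1
  -- `P(κ) ≠ 0` and `P(1) ≠ 0`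
  have hPκ : P.eval κ ≠ 0 := by
    rw [hP, eval_prod]
    refine Finset.prod_ne_zero_iff.mpr fun y hy => ?_
    rw [eval_heckePoly]
    have hy' : y ≠ κ + 1 := fun h => hΛ (h ▸ hy)
    have : κ ^ 2 - y * κ + κ = κ * (κ + 1 - y) := by ring
    rw [this]
    exact mul_ne_zero hκ0 (sub_ne_zero.mpr (Ne.symm hy'))
  have hP1 : P.eval 1 ≠ 0 := by
    rw [hP, eval_prod]
    refine Finset.prod_ne_zero_iff.mpr fun y hy => ?_
    rw [eval_heckePoly]
    have hy' : y ≠ κ + 1 := fun h => hΛ (h ▸ hy)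
    have : (1 : ℂ) ^ 2 - y * 1 + κ = κ + 1 - y := by ring
    rw [this]
    exact sub_ne_zero.mpr (Ne.symm hy')
  have hDp : Dp = 0 := by
    have := mul_eq_zero.mp h0
    rcases this with h' | h'
    · rcases mul_eq_zero.mp h' with h'' | h''
      · exact h''
      · exact absurd h'' (div_ne_zero hκ0 hα)
    · exact absurd h' hPκ
  rw [hDp, zero_mul, zero_mul, neg_zero, zero_sub, neg_eq_zero] at h1
  rcases mul_eq_zero.mp h1 with h' | h'
  · rcases mul_eq_zero.mp h' with h'' | h''
    · exact h''
    · norm_num at h''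
  · exact absurd h' hP1

/-- The same with an arbitrary finite set of values (the value `κ + 1` allowed in `Λ`). [folklore] -/
theorem eq_zero_of_heckeU_sum_eq_indicator_even' {κ : ℂ} (hκ0 : κ ≠ 0) (hκ1 : κ ≠ 1) (hκ2 : κ ≠ -1)
    (Λ : Finset ℂ) (D : ℂ → ℂ) (c₀ : ℂ)
    (h : ∀ a : ℕ, ∑ x ∈ Λ, D x * heckeU κ x a = if Even a then c₀ else 0) : c₀ = 0 := by
  classical
  refine eq_zero_of_heckeU_sum_eq_indicator_even hκ0 hκ1 hκ2 (Finset.notMem_erase (κ + 1) Λ) D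
    (if κ + 1 ∈ Λ then D (κ + 1) else 0) c₀ fun a => ?_
  rw [← h a]
  by_cases hmem : κ + 1 ∈ Λ
  · rw [if_pos hmem, Finset.add_sum_erase Λ (fun x => D x * heckeU κ x a) hmem]
  · rw [if_neg hmem, zero_mul, zero_add, Finset.erase_eq_of_notMem hmem]

/-! ### From Hecke families to the sequences `U` -/

variable {V : Type*} [AddCommGroup V] [Module ℂ V] {N : ℕ} {c : ℕ → ℂ} {T : ℕ → Module.End ℂ V}

/-- **`T(q^a) = U_a(T(q))` on a simultaneous eigenvector**: if `T(q') v = χ(q') v` for all primes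
`q' ∤ N` then `T(q^a) v = U_a(χ(q)) v` with `κ = c(q)`. [cite: Eichler1973, Ch. II §6 Thm. 2] -/
theorem IsHeckeFamily.apply_prime_pow_of_mem_eigenChar (h : IsHeckeFamily N c T) (q : PrimesNotDvd N)
    {χ : PrimesNotDvd N → ℂ} {v : V} (hv : v ∈ eigenChar N T χ) :
    ∀ a : ℕ, T ((q : ℕ) ^ a) v = heckeU (c q) (χ q) a • v
  | 0 => by rw [pow_zero, h.map_one, heckeU_zero, one_smul, Module.End.one_apply]
  | 1 => by rw [pow_one, heckeU_one]; exact mem_eigenChar_iff.mp hv q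
  | a + 2 => by
    rw [h.map_prime_pow q.2.1 q.2.2 a, LinearMap.sub_apply, LinearMap.smul_apply, Module.End.mul_apply,
      h.apply_prime_pow_of_mem_eigenChar q hv (a + 1), map_smul, mem_eigenChar_iff.mp hv q,
      h.apply_prime_pow_of_mem_eigenChar q hv a, heckeU_add_two, smul_smul, smul_smul, ← sub_smul]
    congr 1
    ring

/-- **Trace of `T(q^a)` on the simultaneous eigenspace decomposition**:
`tr T(q^a) = Σ_χ dim V_χ · U_a(χ(q))`. [cite: Pizer1980, Remark 2.27] -/
theorem IsSemisimpleFamily.trace_prime_pow_eq_sum [FiniteDimensional ℂ V] (hs : IsSemisimpleFamily N T)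
    (h : IsHeckeFamily N c T) (q : PrimesNotDvd N) (a : ℕ) :
    LinearMap.trace ℂ V (T ((q : ℕ) ^ a)) =
      ∑ χ ∈ hs.finite_ne_bot.toFinset, (Module.finrank ℂ (eigenChar N T χ) : ℂ) * heckeU (c q) (χ q) a :=
  hs.trace_eq_sum_finrank_eigenChar_mul _ (fun χ => heckeU (c q) (χ q) a)
    fun _ _ hv => h.apply_prime_pow_of_mem_eigenChar q hv a

/-! ### The theorem -/

section Main

variable {A B : Type*} [AddCommGroup A] [Module ℂ A] [AddCommGroup B] [Module ℂ B]
variable [FiniteDimensional ℂ A] [FiniteDimensional ℂ B]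
variable {TA : ℕ → Module.End ℂ A} {TB : ℕ → Module.End ℂ B}

/-- **A square-indicator trace defect vanishes.**  Let `T_A`, `T_B` be semisimple commuting Hecke
families away from `N` with the same prime-power constants `c`, on finite-dimensional complex
spaces, and suppose `tr T_A(n) = tr T_B(n) + δ(n = □) c₀` for all `n ≥ 1` prime to `N`.  If at
some prime `q ∤ N` the constant `c(q)` is not `0`, `1`, `-1` (e.g. `c(q) = q^{k-1}`), then
`c₀ = 0`. [folklore] -/
theorem eq_zero_of_trace_eq_trace_add_indicator_isSquare (hA : IsHeckeFamily N c TA)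
    (hB : IsHeckeFamily N c TB) (hsA : IsSemisimpleFamily N TA) (hsB : IsSemisimpleFamily N TB)
    (q : PrimesNotDvd N) (hc0 : c q ≠ 0) (hc1 : c q ≠ 1) (hc2 : c q ≠ -1) {c₀ : ℂ}
    (htr : ∀ n : ℕ, 0 < n → n.Coprime N →
      LinearMap.trace ℂ A (TA n) = LinearMap.trace ℂ B (TB n) + if IsSquare n then c₀ else 0) :
    c₀ = 0 := by
  classical
  set κ : ℂ := c q with hκ
  set SA := hsA.finite_ne_bot.toFinset with hSA
  set SB := hsB.finite_ne_bot.toFinset with hSB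
  set dA : (PrimesNotDvd N → ℂ) → ℂ := fun χ => (Module.finrank ℂ (eigenChar N TA χ) : ℂ) with hdA
  set dB : (PrimesNotDvd N → ℂ) → ℂ := fun χ => (Module.finrank ℂ (eigenChar N TB χ) : ℂ) with hdB
  have hqpos : ∀ a : ℕ, 0 < (q : ℕ) ^ a := fun a => pow_pos q.2.1.pos a
  have hqcop : ∀ a : ℕ, ((q : ℕ) ^ a).Coprime N := fun a =>
    Nat.Coprime.pow_left a ((Nat.Prime.coprime_iff_not_dvd q.2.1).mpr q.2.2)
  -- the hypothesis at `n = q^a` on the eigenspace decompositions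
  have h1 : ∀ a : ℕ, ∑ χ ∈ SA, dA χ * heckeU κ (χ q) a - ∑ χ ∈ SB, dB χ * heckeU κ (χ q) a =
      if Even a then c₀ else 0 := by
    intro a
    rw [hSA, hSB, hdA, hdB, ← hsA.trace_prime_pow_eq_sum hA q a, ← hsB.trace_prime_pow_eq_sum hB q a,
      htr _ (hqpos a) (hqcop a)]
    simp only [isSquare_prime_pow_iff q.2.1 a]
    ring
  -- group by the value `χ(q)`
  set Λ : Finset ℂ := SA.image (fun χ => χ q) ∪ SB.image (fun χ => χ q) with hΛ
  set D : ℂ → ℂ := fun x =>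
    ∑ χ ∈ SA with χ q = x, dA χ - ∑ χ ∈ SB with χ q = x, dB χ with hD
  have hmapA : ∀ χ ∈ SA, χ q ∈ Λ := fun χ hχ => Finset.mem_union_left _ (Finset.mem_image_of_mem _ hχ)
  have hmapB : ∀ χ ∈ SB, χ q ∈ Λ := fun χ hχ => Finset.mem_union_right _ (Finset.mem_image_of_mem _ hχ)
  have h2 : ∀ a : ℕ, ∑ x ∈ Λ, D x * heckeU κ x a = if Even a then c₀ else 0 := by
    intro a
    rw [← h1 a]
    simp only [hD, sub_mul, Finset.sum_sub_distrib, Finset.sum_mul]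
    have hfibA : ∀ x ∈ Λ, ∑ χ ∈ SA with χ q = x, dA χ * heckeU κ x a =
        ∑ χ ∈ SA with χ q = x, dA χ * heckeU κ (χ q) a := fun x _ =>
      Finset.sum_congr rfl fun χ hχ => by rw [(Finset.mem_filter.mp hχ).2]
    have hfibB : ∀ x ∈ Λ, ∑ χ ∈ SB with χ q = x, dB χ * heckeU κ x a =
        ∑ χ ∈ SB with χ q = x, dB χ * heckeU κ (χ q) a := fun x _ =>
      Finset.sum_congr rfl fun χ hχ => by rw [(Finset.mem_filter.mp hχ).2]
    rw [Finset.sum_congr rfl hfibA, Finset.sum_congr rfl hfibB,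
      Finset.sum_fiberwise_of_maps_to hmapA, Finset.sum_fiberwise_of_maps_to hmapB]
  exact eq_zero_of_heckeU_sum_eq_indicator_even' hc0 hc1 hc2 Λ D c₀ h2

/-- **Corollary: the traces agree**, so `finrank_eigenChar_eq_of_trace_eq` applies. [folklore] -/
theorem trace_eq_of_trace_eq_trace_add_indicator_isSquare (hA : IsHeckeFamily N c TA)
    (hB : IsHeckeFamily N c TB) (hsA : IsSemisimpleFamily N TA) (hsB : IsSemisimpleFamily N TB)
    (q : PrimesNotDvd N) (hc0 : c q ≠ 0) (hc1 : c q ≠ 1) (hc2 : c q ≠ -1) {c₀ : ℂ}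
    (htr : ∀ n : ℕ, 0 < n → n.Coprime N →
      LinearMap.trace ℂ A (TA n) = LinearMap.trace ℂ B (TB n) + if IsSquare n then c₀ else 0) :
    ∀ n : ℕ, 0 < n → n.Coprime N → LinearMap.trace ℂ A (TA n) = LinearMap.trace ℂ B (TB n) := by
  intro n hn hnN
  rw [htr n hn hnN, eq_zero_of_trace_eq_trace_add_indicator_isSquare hA hB hsA hsB q hc0 hc1 hc2 htr]
  simp

end Main

end Literature.NumberTheory.Automorphic

end
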